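import Mathlib.Probability.Independence.Basic
import Mathlib.Analysis.SpecificLimits.Basic
import Literature.Computability.QuantumComplexity.RandomOracleCylinders
import Literature.Barriers.QuantumAdvantage.AaronsonChenPHMeasure
import HarnessLib

/-!
# The random oracle: independent levels and the measure-one diagonalization step

Measure-theoretic toolkit for measure-ONE separations relative to the tree's random oracle
`randomOracleMeasure` (`OracleSeparations.lean`: Mathlib's `setBer(univ, 1/2)` on
`Set (List Bool)`, a uniformly random language), complementing the counting toolkit of
`RandomOracleCylinders.lean` (`restrictBool`, `oracleCylinder`, `IsDetermined`, the bridge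
`randomOracleMeasure_restrictBool`). It packages the classical scheme of Bennett–Gill (1981, §1,
Lemma 1 and its use: "the conditional probability, given the oracle outside the current block,
that the machine is correct on this input is at most `θ < 1`; over infinitely many independent
blocks the machine is correct with probability `0`"), which is also the form in which the random
oracle results of Cai (1986), Babai (1987) and Rossman–Servedio–Tan (2015, Thm. 2, "via Ch. 7 of
Håstad's thesis") multiply per-level correlation bounds:

* `strEvent s = {A | s ∈ A}`; `iIndepSet_strEvent` — the coordinates of the random oracle are
  mutually independent (fair) coins (from the cylinder formula `measure_oracleCylinder`); hence
  `indep_strSigma`: the σ-algebras `strSigma S`, `strSigma T` generated by disjoint sets of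
  strings are independent (Mathlib's `iIndepSet.indep_generateFrom_of_disjoint`);
* `patchFin A₀ U w` — the background `A₀` with the bits `w` patched in on the finite window `U`.
  This is NOT a new notion: it is `patchLang A₀ (Subtype.val : U → List Bool) w` of
  `OracleSeparationBQPPH.lean` (the patch along an injective address map `e : ι → List Bool`,
  here the inclusion of the finite set `U`), restated only because importing that file here would
  drag the whole Raz–Tal closure into this measure-theoretic toolkit; the identity is proved where
  both are in scope (`RandomOraclePHProofs.lean`, `patchFin_eq_patchLang`), and a librarian hoist
  of `patchLang` + `mem_patchLang_of_eq` / `mem_patchLang_of_not_mem_range` into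
  `RandomOracleCylinders.lean` would let `patchFin` become an `abbrev` of it.
  `patchFin_sdiff_restrictBool`: every oracle is its own background patched by its own window;
  `indepFun_restrictBool_sdiff`: window `restrictBool U` and background `· \ U` are independent;
* `measure_inter_le_of_window` — **the conditioning step**: if `F` does not depend on the window
  `U` and, for EVERY background `A₀`, at most a `θ`-fraction of the `2^{|U|}` windows `w` put
  `patchFin A₀ U w` into `E`, then `μ (E ∩ F) ≤ θ · μ F` (via the generic product-law lemma
  `measure_rel_inter_le` of `AaronsonChenPHMeasure.lean`);
* `measure_biInter_le_pow`, `measure_iInter_eq_zero_of_windows` — **the product bound**: for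
  events `E j` and windows `U j` such that `E i` ignores the window `U j` whenever `i < j`, and
  per-window conditional bounds `θ`, `μ (⋂_{j<J} E j) ≤ θ^J`, so `μ (⋂ⱼ E j) = 0` when `θ < 1`.

Everything here is proved; no complexity theory is involved.

## References

* C. H. Bennett, J. Gill, *Relative to a random oracle `A`, `P^A ≠ NP^A ≠ co-NP^A` with
  probability 1*, SIAM J. Comput. 10 (1981), §1, Lemma 1 [BennettGill1981].
* B. Rossman, R. A. Servedio, L.-Y. Tan, FOCS 2015, arXiv:1504.03398, §2.3 (Thm. 2 from Thm. 1
  via Håstad's thesis, Ch. 7) [RossmanServedioTan2015].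
* Mathlib: `ProbabilityTheory.iIndepSet_iff_meas_biInter`,
  `iIndepSet.indep_generateFrom_of_disjoint`, `ENNReal.tendsto_pow_atTop_nhds_zero_of_lt_one`.
-/

noncomputable section

namespace Literature.Computability.QuantumComplexity

open _root_.MeasureTheory _root_.ProbabilityTheory Filter Literature.Barriers.QuantumAdvantage
open scoped ENNReal

/-! ### The coordinates of the random oracle are independent fair coins -/

/-- The coordinate event "the string `s` belongs to the oracle". [folklore] -/
def strEvent (s : List Bool) : Set (Set (List Bool)) := {A | s ∈ A}

/-- Coordinate events are measurable. [folklore] -/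
theorem measurableSet_strEvent (s : List Bool) : MeasurableSet (strEvent s) :=
  measurableSet_mem s

/-- A finite intersection of coordinate events is the all-`true` cylinder. [folklore] -/
theorem biInter_strEvent_eq (S : Finset (List Bool)) :
    (⋂ s ∈ S, strEvent s) = oracleCylinder S fun _ => true := by
  ext A
  simp only [Set.mem_iInter, strEvent, Set.mem_setOf_eq, mem_oracleCylinder_iff]
  constructor
  · intro h
    funext u
    exact (restrictBool_eq_true_iff S A u).2 (h u u.2)
  · intro h s hs
    exact (restrictBool_eq_true_iff S A ⟨s, hs⟩).1 (congrFun h ⟨s, hs⟩)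

/-- A finite intersection of coordinate events has probability `2^{-|S|}`. [folklore] -/
theorem randomOracleMeasure_biInter_strEvent (S : Finset (List Bool)) :
    randomOracleMeasure (⋂ s ∈ S, strEvent s) = 2⁻¹ ^ S.card := by
  rw [biInter_strEvent_eq, measure_oracleCylinder]

/-- Each string belongs to the random oracle with probability `1/2`. [cite: BennettGill1981, §1] -/
theorem randomOracleMeasure_strEvent (s : List Bool) : randomOracleMeasure (strEvent s) = 2⁻¹ := by
  simpa using randomOracleMeasure_biInter_strEvent {s}

/-- **The coordinates of the random oracle are mutually independent** (a product of fair coins: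
finite intersections of coordinate events have the product probability). [cite: BennettGill1981, §1] -/
theorem iIndepSet_strEvent : iIndepSet strEvent randomOracleMeasure := by
  rw [iIndepSet_iff_meas_biInter fun s => measurableSet_strEvent s]
  intro S
  rw [randomOracleMeasure_biInter_strEvent,
    Finset.prod_congr rfl fun s _ => randomOracleMeasure_strEvent s, Finset.prod_const]

/-! ### σ-algebras of sets of strings -/

/-- The σ-algebra generated by the coordinates in `T`. [folklore] -/
@[reducible] def strSigma (T : Set (List Bool)) : MeasurableSpace (Set (List Bool)) :=
  MeasurableSpace.generateFrom {E | ∃ s ∈ T, strEvent s = E}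

/-- Coordinate σ-algebras are sub-σ-algebras of the product σ-algebra. [folklore] -/
theorem strSigma_le (T : Set (List Bool)) :
    strSigma T ≤ (inferInstance : MeasurableSpace (Set (List Bool))) :=
  MeasurableSpace.generateFrom_le (by rintro E ⟨s, -, rfl⟩; exact measurableSet_strEvent s)

/-- A coordinate of `T` generates a `strSigma T`-measurable event. [folklore] -/
theorem measurableSet_strSigma_strEvent {T : Set (List Bool)} {s : List Bool} (hs : s ∈ T) :
    MeasurableSet[strSigma T] (strEvent s) :=
  MeasurableSpace.measurableSet_generateFrom ⟨s, hs, rfl⟩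

/-- Prescribing one coordinate of `T` is a `strSigma T`-measurable event. [folklore] -/
theorem measurableSet_strSigma_iff {T : Set (List Bool)} {s : List Bool} (hs : s ∈ T) (P : Prop) :
    MeasurableSet[strSigma T] {A | s ∈ A ↔ P} := by
  by_cases hP : P
  · have : {A : Set (List Bool) | s ∈ A ↔ P} = strEvent s := by ext A; simp [strEvent, hP]
    rw [this]
    exact measurableSet_strSigma_strEvent hs
  · have : {A : Set (List Bool) | s ∈ A ↔ P} = (strEvent s)ᶜ := by ext A; simp [strEvent, hP]
    rw [this]
    exact (measurableSet_strSigma_strEvent hs).compl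

/-- **σ-algebras of disjoint sets of strings are independent.** [cite: BennettGill1981, §1] -/
theorem indep_strSigma {S T : Set (List Bool)} (h : Disjoint S T) :
    Indep (strSigma S) (strSigma T) randomOracleMeasure :=
  iIndepSet_strEvent.indep_generateFrom_of_disjoint (fun s => measurableSet_strEvent s) S T h

/-- The window map `restrictBool U` is measurable with respect to the coordinates of `U`. [folklore] -/
theorem measurable_strSigma_restrictBool (U : Finset (List Bool)) :
    Measurable[strSigma (↑U : Set (List Bool))] (restrictBool U) := by
  refine @measurable_to_countable' (U → Bool) (Set (List Bool)) _ _ (strSigma ↑U) (restrictBool U)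
    fun τ => ?_
  have hset : restrictBool U ⁻¹' {τ} =
      ⋂ u : U, {A : Set (List Bool) | (u : List Bool) ∈ A ↔ τ u = true} := by
    ext A
    simp only [Set.mem_preimage, Set.mem_singleton_iff, Set.mem_iInter, Set.mem_setOf_eq]
    constructor
    · intro h u
      rw [← restrictBool_eq_true_iff U A u, h]
    · intro h
      funext u
      rw [Bool.eq_iff_iff, restrictBool_eq_true_iff U A u]
      exact h u
  rw [hset]
  exact MeasurableSet.iInter fun u => measurableSet_strSigma_iff u.2 _

/-- The background map `A ↦ A \ U` is measurable with respect to the coordinates off `U`. [folklore] -/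
theorem measurable_strSigma_sdiff (U : Finset (List Bool)) :
    Measurable[strSigma (↑U : Set (List Bool))ᶜ] fun A : Set (List Bool) => A \ ↑U := by
  refine (@measurable_set_iff (List Bool) (Set (List Bool)) (strSigma (↑U)ᶜ)
    fun A : Set (List Bool) => A \ ↑U).2 fun z => ?_
  refine (@measurableSet_setOf (Set (List Bool)) (strSigma (↑U)ᶜ)
    fun A : Set (List Bool) => z ∈ A \ ↑U).1 ?_
  by_cases hz : z ∈ U
  · have : {A : Set (List Bool) | z ∈ A \ ↑U} = ∅ := by
      ext A; simp [hz]
    rw [this]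
    exact @MeasurableSet.empty _ (strSigma (↑U : Set (List Bool))ᶜ)
  · have : {A : Set (List Bool) | z ∈ A \ ↑U} = strEvent z := by
      ext A; simp [strEvent, hz]
    rw [this]
    exact measurableSet_strSigma_strEvent (show z ∈ (↑U : Set (List Bool))ᶜ from hz)

/-- The background map is measurable. [folklore] -/
theorem measurable_sdiff_finset (U : Finset (List Bool)) :
    Measurable fun A : Set (List Bool) => A \ ↑U :=
  (measurable_strSigma_sdiff U).mono (strSigma_le _) le_rfl

/-- **Window and background are independent**: the bits of the random oracle on a finite set `U`
of strings and the oracle off `U` are independent. [cite: BennettGill1981, §1] -/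
theorem indepFun_restrictBool_sdiff (U : Finset (List Bool)) :
    IndepFun (restrictBool U) (fun A : Set (List Bool) => A \ ↑U) randomOracleMeasure := by
  rw [IndepFun_iff_Indep]
  exact indep_of_indep_of_le (indep_strSigma disjoint_compl_right)
    (measurable_iff_comap_le.1 (measurable_strSigma_restrictBool U))
    (measurable_iff_comap_le.1 (measurable_strSigma_sdiff U))

/-! ### Patching a window into a background -/

/-- The background `A₀` with the bits `w` patched in on the finite window `U`: a string of `U`
belongs to the result iff its bit in `w` is set, any other string iff it belongs to `A₀`
(Bennett–Gill: the oracle agreeing with a finite table on its domain and with `A₀` elsewhere).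
This is `patchLang A₀ (Subtype.val : U → List Bool) w` of `OracleSeparationBQPPH.lean` (same
directory), spelled out to keep that file's Raz–Tal imports out of this toolkit; see the module
docstring (identity `patchFin_eq_patchLang` in `RandomOraclePHProofs.lean`; hoist wanted). [cite: BennettGill1981, §1] -/
def patchFin (A₀ : Set (List Bool)) (U : Finset (List Bool)) (w : U → Bool) : Set (List Bool) :=
  {s | if h : s ∈ U then w ⟨s, h⟩ = true else s ∈ A₀}

/-- On the window, the patched oracle reads the patched bits. [folklore] -/
theorem mem_patchFin_of_mem {A₀ : Set (List Bool)} {U : Finset (List Bool)} (w : U → Bool)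
    {s : List Bool} (h : s ∈ U) : s ∈ patchFin A₀ U w ↔ w ⟨s, h⟩ = true := by
  simp [patchFin, h]

/-- Off the window, the patched oracle reads the background. [folklore] -/
theorem mem_patchFin_of_not_mem {A₀ : Set (List Bool)} {U : Finset (List Bool)} (w : U → Bool)
    {s : List Bool} (h : s ∉ U) : s ∈ patchFin A₀ U w ↔ s ∈ A₀ := by
  simp [patchFin, h]

/-- **Every oracle is its own background patched by its own window.** [folklore] -/
theorem patchFin_sdiff_restrictBool (A : Set (List Bool)) (U : Finset (List Bool)) :
    patchFin (A \ ↑U) U (restrictBool U A) = A := by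
  ext s
  by_cases h : s ∈ U
  · rw [mem_patchFin_of_mem _ h, restrictBool_eq_true_iff]
  · rw [mem_patchFin_of_not_mem _ h]
    simp [h]

/-- The window of a patched oracle is the patch. [folklore] -/
theorem restrictBool_patchFin (A₀ : Set (List Bool)) (U : Finset (List Bool)) (w : U → Bool) :
    restrictBool U (patchFin A₀ U w) = w := by
  funext u
  rw [Bool.eq_iff_iff, restrictBool_eq_true_iff]
  exact mem_patchFin_of_mem w u.2

/-- The background of a patched oracle is the background (off the window). [folklore] -/
theorem patchFin_sdiff (A₀ : Set (List Bool)) (U : Finset (List Bool)) (w : U → Bool) :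
    patchFin A₀ U w \ ↑U = A₀ \ ↑U := by
  ext s
  by_cases h : s ∈ U
  · simp [h]
  · simp [h, mem_patchFin_of_not_mem w h]

/-- Patching only reads the background off the window. [folklore] -/
theorem patchFin_sdiff_left (A₀ : Set (List Bool)) (U : Finset (List Bool)) (w : U → Bool) :
    patchFin (A₀ \ ↑U) U w = patchFin A₀ U w := by
  ext s
  by_cases h : s ∈ U
  · rw [mem_patchFin_of_mem _ h, mem_patchFin_of_mem _ h]
  · rw [mem_patchFin_of_not_mem _ h, mem_patchFin_of_not_mem _ h]
    simp [h]

/-- Two patched oracles with the same background and window agree iff the patches agree; in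
particular `w ↦ patchFin A₀ U w` is injective. [folklore] -/
theorem patchFin_injective (A₀ : Set (List Bool)) (U : Finset (List Bool)) :
    Function.Injective (patchFin A₀ U) := fun w w' h => by
  rw [← restrictBool_patchFin A₀ U w, h, restrictBool_patchFin]

/-- Patching is measurable in the background. [folklore] -/
theorem measurable_patchFin (U : Finset (List Bool)) (w : U → Bool) :
    Measurable fun A₀ : Set (List Bool) => patchFin A₀ U w := by
  refine measurable_set_iff.2 fun z => measurableSet_setOf.1 ?_
  by_cases hz : z ∈ U
  · have : {A₀ : Set (List Bool) | z ∈ patchFin A₀ U w} = {A₀ | w ⟨z, hz⟩ = true} := by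
      ext A₀; exact mem_patchFin_of_mem w hz
    rw [this]
    exact MeasurableSet.const _
  · have : {A₀ : Set (List Bool) | z ∈ patchFin A₀ U w} = {A₀ | z ∈ A₀} := by
      ext A₀; exact mem_patchFin_of_not_mem w hz
    rw [this]
    exact measurableSet_mem z

/-- The windows putting a given background into `E`. [folklore] -/
def goodWindows (E : Set (Set (List Bool))) (U : Finset (List Bool)) (A₀ : Set (List Bool)) :
    Finset (U → Bool) :=
  open scoped Classical in Finset.univ.filter fun w => patchFin A₀ U w ∈ E

/-- Membership in `goodWindows`. [folklore] -/
theorem mem_goodWindows_iff {E : Set (Set (List Bool))} {U : Finset (List Bool)}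
    {A₀ : Set (List Bool)} {w : U → Bool} : w ∈ goodWindows E U A₀ ↔ patchFin A₀ U w ∈ E := by
  classical
  simp [goodWindows]

/-- The probability that the random oracle, with its background replaced by `A₀`, lies in `E`
is the fraction of good windows. [cite: BennettGill1981, §1] -/
theorem randomOracleMeasure_patchFin_mem (E : Set (Set (List Bool))) (U : Finset (List Bool))
    (A₀ : Set (List Bool)) :
    randomOracleMeasure {A | patchFin A₀ U (restrictBool U A) ∈ E} =
      (goodWindows E U A₀).card * 2⁻¹ ^ U.card := by
  rw [← randomOracleMeasure_restrictBool U (goodWindows E U A₀)]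
  congr 1
  ext A
  simp only [Set.mem_setOf_eq, mem_goodWindows_iff]

/-! ### The conditioning step and the product bound -/

/-- **The conditioning step** (Bennett–Gill 1981, Lemma 1 in use): let `U` be a finite set of
strings, `E` a measurable event, and `F` a measurable event that does not depend on the bits in
`U`. If for every background `A₀` at most a `θ`-fraction of the windows `w ∈ {0,1}^U` put
`patchFin A₀ U w` into `E`, then `μ (E ∩ F) ≤ θ · μ F`. [cite: BennettGill1981, §1 (Lemma 1)] -/
theorem measure_inter_le_of_window (U : Finset (List Bool)) {E F : Set (Set (List Bool))}
    {θ : ℝ≥0∞} (hE : MeasurableSet E) (hF : MeasurableSet F)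
    (hFU : ∀ A : Set (List Bool), A ∈ F ↔ A \ ↑U ∈ F)
    (hθ : ∀ A₀ : Set (List Bool), ((goodWindows E U A₀).card : ℝ≥0∞) * 2⁻¹ ^ U.card ≤ θ) :
    randomOracleMeasure (E ∩ F) ≤ θ * randomOracleMeasure F := by
  set X : Set (List Bool) → (U → Bool) := restrictBool U with hX
  set Y : Set (List Bool) → Set (List Bool) := fun A => A \ ↑U with hY
  set R : (U → Bool) → Set (List Bool) → Prop := fun w A₀ => patchFin A₀ U w ∈ E with hR
  have hEF : E ∩ F = {A | R (X A) (Y A)} ∩ Y ⁻¹' F := by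
    ext A
    simp only [Set.mem_inter_iff, Set.mem_setOf_eq, Set.mem_preimage, hR, hX, hY,
      patchFin_sdiff_restrictBool]
    exact and_congr_right fun _ => hFU A
  have hFY : F = Y ⁻¹' F := by ext A; exact hFU A
  have hRm : ∀ w, MeasurableSet {A₀ | R w A₀} := fun w => hE.preimage (measurable_patchFin U w)
  have hθ' : ∀ A₀ ∈ F, randomOracleMeasure {A | R (X A) A₀} ≤ θ := fun A₀ _ => by
    simp only [hR, hX]
    rw [randomOracleMeasure_patchFin_mem]
    exact hθ A₀
  rw [hEF]
  conv_rhs => rw [hFY]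
  exact measure_rel_inter_le (measurable_restrictBool U) (measurable_sdiff_finset U)
    (indepFun_restrictBool_sdiff U) hRm hF hθ'

/-- **The product bound** (Bennett–Gill 1981, §1; the form in which per-level bounds are
multiplied in measure-one oracle separations): windows `U j` and measurable events `E j` such
that `E i` does not depend on the bits in `U j` whenever `i < j`, each with conditional bound
`θ` for every background; then `μ (⋂_{j<J} E j) ≤ θ^J`. [cite: BennettGill1981, §1] -/
theorem measure_biInter_le_pow (U : ℕ → Finset (List Bool)) (E : ℕ → Set (Set (List Bool)))
    {θ : ℝ≥0∞} (hE : ∀ j, MeasurableSet (E j))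
    (hsep : ∀ i j : ℕ, i < j → ∀ A : Set (List Bool), A ∈ E i ↔ A \ ↑(U j) ∈ E i)
    (hθ : ∀ (j : ℕ) (A₀ : Set (List Bool)),
      ((goodWindows (E j) (U j) A₀).card : ℝ≥0∞) * 2⁻¹ ^ (U j).card ≤ θ) :
    ∀ J : ℕ, randomOracleMeasure (⋂ j ∈ Finset.range J, E j) ≤ θ ^ J
  | 0 => by simp
  | J + 1 => by
    rw [Finset.range_add_one, Finset.set_biInter_insert, pow_succ']
    have ih := measure_biInter_le_pow U E hE hsep hθ J
    refine (measure_inter_le_of_window (U J) (hE J)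
      (Finset.measurableSet_biInter _ fun j _ => hE j) (fun A => ?_) (hθ J)).trans ?_
    · simp only [Set.mem_iInter, Finset.mem_range]
      exact forall₂_congr fun i hi => hsep i J hi A
    · exact mul_le_mul' le_rfl ih

/-- **Measure-one diagonalization**: under the hypotheses of `measure_biInter_le_pow` with
`θ < 1`, the events `E j` hold simultaneously with probability `0`. [cite: BennettGill1981, §1] -/
theorem measure_iInter_eq_zero_of_windows (U : ℕ → Finset (List Bool))
    (E : ℕ → Set (Set (List Bool))) {θ : ℝ≥0∞} (hθ1 : θ < 1) (hE : ∀ j, MeasurableSet (E j))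
    (hsep : ∀ i j : ℕ, i < j → ∀ A : Set (List Bool), A ∈ E i ↔ A \ ↑(U j) ∈ E i)
    (hθ : ∀ (j : ℕ) (A₀ : Set (List Bool)),
      ((goodWindows (E j) (U j) A₀).card : ℝ≥0∞) * 2⁻¹ ^ (U j).card ≤ θ) :
    randomOracleMeasure (⋂ j, E j) = 0 := by
  refine le_antisymm ?_ bot_le
  have h : ∀ J : ℕ, randomOracleMeasure (⋂ j, E j) ≤ θ ^ J := fun J =>
    (measure_mono (Set.subset_iInter₂ fun j _ => Set.iInter_subset E j)).trans
      (measure_biInter_le_pow U E hE hsep hθ J)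
  exact ge_of_tendsto' (ENNReal.tendsto_pow_atTop_nhds_zero_of_lt_one hθ1) h

end Literature.Computability.QuantumComplexity

end
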